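import Summits.ResolutionOfSingularities.ResolutionOfSingularities.Theorems.UniformWalkKernels
import Summits.ResolutionOfSingularities.ResolutionOfSingularities.Theorems.LassoCutAxisTails
import Literature.AlgebraicGeometry.Resolution.PrincipalRidgeHasseCoefficients
import HarnessLib

/-!
# UniformWalkTangentCone — §4.6 of the decomp-res node «UniformWalks» (lens-5 g12 REBASED, sha256
00c8d33cfdb7c8ff; critic rows 67/72)

THE TANGENT-CONE RUNG, decided in the model (`B = 1` on the slice `deg F ≤ q`, all fields), VERBATIM from the lens
file: if the residual
polynomial of a root has total degree `≤ q` then after ONE forced step the new residual polynomial omits the chart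
variable (`NoVar`),
its order-`q` Hasse derivatives span an ideal inside `(u_k : k ≠ j)`, and the origin is NOT an isolated top point
— so there is no forced
run of length 2: `tangentCone_noRun`, `tangentConeRung : TangentConeRung`, `unifBound_two_one`,
`sliceTerminate_two`, `unifFin_two_one`
[DECIDED · PROVED; critic: degenerate first line, no piece credit].  [WRITER NOTE (decomp-res writer g5): lens
`coeff_hasseDeriv_eq` is the
tree's `LassoCut.coeff_hasseDeriv_eq` (`Theorems.LassoCutAxisTails`, same statement) and is cited, not restated.]
(Sources: Hauser2010 §§F–G; Kollar2007 p.35.)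
-/

open CategoryTheory AlgebraicGeometry
open Literature.AlgebraicGeometry.Resolution
open Summit.ResolutionOfSingularities.ResolutionOfSingularities.Theorems
open Summit.ResolutionOfSingularities.ResolutionOfSingularities.Theorems.WeakOrderReduction
open Summit.ResolutionOfSingularities.ResolutionOfSingularities.Theorems.ForcedTowerClasses
open Summit.ResolutionOfSingularities.ResolutionOfSingularities.Theorems.TightDefectClasses
open Summit.ResolutionOfSingularities.ResolutionOfSingularities.Theorems.LassoCut (coeff_hasseDeriv_eq)

namespace Summit.ResolutionOfSingularities.ResolutionOfSingularities.Theorems.UniformWalks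

/-! ## §4 Kernels (PROVED, no sorry) -/

section Kernels

open MvPolynomial
open Literature.AlgebraicGeometry.Resolution.Hauser2010
open Literature.AlgebraicGeometry.Resolution.PointBlowup
open Literature.Barriers.ResolutionOfSingularities

/-! ### 4.6 The TANGENT-CONE RUNG, decided in the model (`B = 1` on the slice `deg F ≤ q`, all fields) -/

section TangentCone

variable {K : Type} [Field K] [DecidableEq K]

/-- The variable `u_j` does not occur in `P`.  DEFINITION (support). -/
def NoVar (j : Fin 3) (P : MvPolynomial (Fin 3) K) : Prop :=
  ∀ m ∈ P.support, m j = 0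

omit [DecidableEq K] in
/-- The chart transform in the `u_j`-chart of a polynomial of degree `≤ q` is free of `u_j`
(`(d^)_j = |d| − q = 0`). [folklore] -/
theorem noVar_chartTransform {q : ℕ} (j : Fin 3) {F : MvPolynomial (Fin 3) K} (hF : F.totalDegree ≤ q) :
    NoVar j (PointBlowup.chartTransform q j F) := by
  classical
  intro m hm
  unfold PointBlowup.chartTransform at hm
  obtain ⟨d, hd, hmd⟩ := Finset.mem_biUnion.mp (MvPolynomial.support_sum hm)
  have hm' : m = chartExponent q j d := Finset.mem_singleton.mp (MvPolynomial.support_monomial_subset hmd)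
  rw [hm', chartExponent_apply, if_pos rfl]
  have := (degree_le_totalDegree hd).trans hF
  omega

omit [DecidableEq K] in
/-- Translation keeps `u_j`-freeness (supports only go down: tree `exists_le_of_mem_support_translate`). [folklore] -/
theorem noVar_translate (j : Fin 3) (b : Fin 3 → K) {P : MvPolynomial (Fin 3) K} (hP : NoVar j P) :
    NoVar j (PointBlowup.translate b P) := by
  intro m hm
  obtain ⟨e, he, hle⟩ := exists_le_of_mem_support_translate b P hm
  have h1 := hle j
  rw [hP e he] at h1
  omega

omit [DecidableEq K] in
/-- Cleaning only deletes monomials. [folklore] -/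
theorem mem_support_of_mem_support_deletePthPowers' {q : ℕ} {P : MvPolynomial (Fin 3) K} {m : Fin 3 →₀ ℕ}
    (hm : m ∈ (deletePthPowers q P).support) : m ∈ P.support := by
  rw [MvPolynomial.mem_support_iff, coeff_deletePthPowers] at hm
  rw [MvPolynomial.mem_support_iff]
  intro h
  apply hm
  split_ifs
  · rfl
  · exact h

omit [DecidableEq K] in
/-- Cleaning keeps `u_j`-freeness. [folklore] -/
theorem noVar_deletePthPowers (j : Fin 3) (q : ℕ) {P : MvPolynomial (Fin 3) K} (hP : NoVar j P) :
    NoVar j (deletePthPowers q P) :=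
  fun m hm => hP m (mem_support_of_mem_support_deletePthPowers' hm)

/-- **After one point blow-up of a state of degree `≤ q`, the new residual polynomial is free of the chart variable.**
[folklore] -/
theorem noVar_step_F {q : ℕ} (j : Fin 3) (b : Fin 3 → K) {s : State (Fin 3) K} (hs : s.F.totalDegree ≤ q) :
    NoVar j (step q j b s).F := by
  change NoVar j (deletePthPowers q (PointBlowup.translate b (PointBlowup.chartTransform q j s.F)))
  exact noVar_deletePthPowers j q (noVar_translate j b (noVar_chartTransform j hs))

omit [DecidableEq K] in
omit [DecidableEq K] in
/-- The generators `∂^{(α)}F` (`0 < |α| < q`) of the top ideal of a `u_j`-free polynomial without monomials of degree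
`0 < |m| < q` lie in the ideal `(u_i : i ≠ j)` of the `u_j`-AXIS. [folklore] -/
theorem hasseDeriv_mem_span_of_noVar {q : ℕ} {j : Fin 3} {F : MvPolynomial (Fin 3) K} (hF : NoVar j F)
    (hord : ∀ m : Fin 3 →₀ ℕ, m ≠ 0 → m.degree < q → coeff m F = 0)
    {α : Fin 3 →₀ ℕ} (hα0 : α ≠ 0) (hαq : α.degree < q) :
    hasseDeriv K α F ∈ Ideal.span (MvPolynomial.X '' {i : Fin 3 | i ≠ j} : Set (MvPolynomial (Fin 3) K)) := by
  classical
  rw [MvPolynomial.mem_ideal_span_X_image]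
  intro m hm
  rw [MvPolynomial.mem_support_iff, coeff_hasseDeriv_eq] at hm
  have hαm : coeff (α + m) F ≠ 0 := fun h => hm (by rw [h, mul_zero])
  have hmem : α + m ∈ F.support := MvPolynomial.mem_support_iff.mpr hαm
  have hm0 : m ≠ 0 := by
    rintro rfl
    exact hαm (by rw [add_zero]; exact hord α hα0 hαq)
  have hmj : m j = 0 := by
    have h1 := hF _ hmem
    rw [Finsupp.add_apply] at h1
    omega
  have hex : ∃ i, m i ≠ 0 := by
    by_contra h
    exact hm0 (Finsupp.ext fun i => by
      by_contra hi
      exact h ⟨i, hi⟩)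
  obtain ⟨i, hi⟩ := hex
  refine ⟨i, ?_, hi⟩
  show i ≠ j
  rintro rfl
  exact hi hmj

omit [DecidableEq K] in
/-- … hence the whole top ideal lies in the ideal of the `u_j`-axis. [folklore] -/
theorem topIdeal_le_span_of_noVar {q : ℕ} {j : Fin 3} {F : MvPolynomial (Fin 3) K} (hF : NoVar j F)
    (hord : ∀ m : Fin 3 →₀ ℕ, m ≠ 0 → m.degree < q → coeff m F = 0) :
    topIdeal q F ≤ Ideal.span (MvPolynomial.X '' {i : Fin 3 | i ≠ j} : Set (MvPolynomial (Fin 3) K)) := by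
  refine Ideal.span_le.mpr ?_
  rintro _ ⟨α, ⟨hα0, hαq⟩, rfl⟩
  exact hasseDeriv_mem_span_of_noVar hF hord hα0 hαq

omit [DecidableEq K] in
/-- **A `u_j`-free state of order `≥ q` is NOT an isolated top point** (the top locus contains the `u_j`-axis: an
isolation witness `g·u_j^N ∈ J_F ⊆ (u_i : i ≠ j)` would put the pure power `u_j^N` (coefficient `g(0) ≠ 0`)
into the axis
ideal). [folklore] -/
theorem not_isolatedTop_of_noVar {q : ℕ} {j : Fin 3} {F : MvPolynomial (Fin 3) K} (hF : NoVar j F)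
    (hord : ∀ m : Fin 3 →₀ ℕ, m ≠ 0 → m.degree < q → coeff m F = 0) : ¬ IsolatedTop q F := by
  classical
  rintro ⟨N, g, hg0, hg⟩
  have hmem := topIdeal_le_span_of_noVar hF hord (hg j)
  rw [MvPolynomial.mem_ideal_span_X_image] at hmem
  have hg0' : coeff 0 g ≠ 0 := hg0
  have hsupp : Finsupp.single j N ∈ (g * X j ^ N).support := by
    rw [MvPolynomial.mem_support_iff, MvPolynomial.X_pow_eq_monomial, MvPolynomial.coeff_mul_monomial',
      if_pos le_rfl, tsub_self, mul_one]
    exact hg0'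
  obtain ⟨i, hi, hne⟩ := hmem _ hsupp
  have hij : i ≠ j := hi
  exact hne (by rw [Finsupp.single_apply, if_neg (Ne.symm hij)])

/-- **The tangent-cone rung in the model**: a state of degree `≤ q` has no forced run of length `2` (any field, any
`q`): after the first (equimultiple) step the residual polynomial is `u_j`-free of order `≥ q`, so the second point is
not an isolated top point. [folklore] -/
theorem tangentCone_noRun {q : ℕ} {s₀ : State (Fin 3) K} (hq : s₀.F.totalDegree ≤ q) (R : ForcedRun q s₀ 2) :
    False := by
  have h1 : R.st 1 = step q (R.j 0) (R.b 0) s₀ := by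
    have h := R.st_succ 0 (by norm_num)
    rw [R.st_zero] at h
    exact h
  have hiso : IsolatedTop q (R.st 1).F := R.isolated 1 (by norm_num)
  have heq : IsEquimultiplePoint q (R.j 0) (R.b 0) (R.st 0) := R.equimult 0 (by norm_num)
  rw [R.st_zero] at heq
  rw [h1] at hiso
  refine not_isolatedTop_of_noVar (noVar_step_F (R.j 0) (R.b 0) hq) ?_ hiso
  intro m hm0 hmq
  change coeff m (deletePthPowers q (pointTransform q (R.j 0) (R.b 0) s₀)) = 0
  rw [coeff_deletePthPowers]
  split_ifs
  · rfl
  · exact heq m hm0 hmq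

/-- **DECIDED: `TangentConeRung`.** [folklore] -/
theorem tangentConeRung : TangentConeRung :=
  fun _ _ _ _ _ _ _ _ _ _ _ hd R => tangentCone_noRun hd R

/-- **DECIDED CELL `UnifBound 2 1`**: at degree `2` (necessarily `pᵉ = 2`) every forced walk over every perfect field
stops after ONE step. [folklore] -/
theorem unifBound_two_one : UnifBound 2 1 := by
  intro p hp e he K _ _ _ _ s₀ hs hd R
  exact tangentCone_noRun (hd.trans (le_trans hp.two_le (Nat.le_self_pow (by omega) p))) R

/-- **DECIDED SLICE `SliceTerminate 2`** (the first non-vacuous degree slice is a theorem). [folklore] -/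
theorem sliceTerminate_two : SliceTerminate 2 :=
  sliceTerminate_of_unifBound unifBound_two_one

/-- … and its finite-field shadows (the sanity line of T-unif-1 at `d = 2`). [folklore] -/
theorem unifFin_two_one : UnifFin 2 1 :=
  unifFin_of_unifBound unifBound_two_one

end TangentCone

end Kernels

end Summit.ResolutionOfSingularities.ResolutionOfSingularities.Theorems.UniformWalks
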